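import Summits.BirchSwinnertonDyer.BirchSwinnertonDyer.Theorems.QuadraticBranchSignedControlPlusEtaBottomLayerFinite
import HarnessLib

/-!
# Route `QuadraticBranchSignedControl` (rung K8, cell `bsd-potss`), residual crux
# `PlusEtaMainConjectureNonsurj` (stmt-BirchSwinnertonDyer-19606): the UNIT ROWS at the bottom layer —
# `Sel_{p^∞}(W/ℚ) = 0 ∧ p ∤ Tam(W) ⟹ Sel^{loc,∞,+}(W/ℚ) = 0 ⟹ (Sel⁺(W/ℚ_∞))^Γ = 0 ⟹ Sel⁺(W/ℚ_∞) = 0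
# ⟹ X⁺_W(ℚ_∞) = X⁺(V/K_∞)^η = 0` for EVERY dual datum, with NO Kato / image / Thm. 2.2 / KO / PT input
# (seat `bsd-potss-k8eta-c2` g2; sequel of `…PlusEtaBottomLayerFinite.lean`)

WHAT. `W/ℚ` globally minimal is the additive partner of a globally minimal good supersingular
`a_p = 0` curve `V` (`C • W^{(p*)} = V`, `p ≥ 5`), `κ` the cyclotomic `ℤ_p`-extension, `γ` a
topological generator, `A₀⁺ = Sel^{loc,∞,+}(W/ℚ)` (classes over `ℚ` whose restriction to `ℚ_∞` is
plus-Selmer), `S₀⁺ = Sel⁺(W/ℚ_0)` (`#S₀⁺ = #Sel_{p^∞}(W/ℚ)`, ctrl g2 file 1).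
* `localPreimage_le_layer_of_not_dvd_tamagawa` — **`p ∤ Tam(W)` ⟹ `A₀⁺ = S₀⁺`**: the index
  `[A₀⁺ : S₀⁺]` divides `∏_{v ≠ p} p^{ord_p c_v(W)} = p^{ord_p Tam(W)} = 1` (file 1's instance-free
  `natCard_quotient_dvd_prod_pow`; `c_p(W) ≤ 4 < p`).
* `localPreimage_trivial_of_selmer_trivial_of_not_dvd_tamagawa` — with `Sel_{p^∞}(W/ℚ) = 0`: `A₀⁺ = 0`.
* `invariants_trivial_of_selmer_trivial_of_not_dvd_tamagawa` — hence `(Sel⁺(W/ℚ_∞))^γ = 0` (a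
  `conj_γ`-fixed class is `h₀ y`, `y ∈ A₀⁺`: Greenberg's Lemma 3.2, `cd_p Γ = 1`, the tree's
  `SubSelmerControlZero.exists_layerToInfty_eq_of_mem_endInvariants`, with x1b's B2 identification).
* **`subsingleton_X_of_selmer_trivial_of_not_dvd_tamagawa`** — hence `X⁺ = 0` for EVERY Pontryagin-dual
  datum `D : StrictSignedSelmerDualData W κ ℚ_[p] γ 1` (file 1 §1b: local nilpotence of `conj_γ − 1`,
  no Nakayama), so `Char(X⁺) = Λ`, `X⁺` f.g. torsion, no finite submodule — Greenberg's Prop. 3.8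
  ("if `Sel_E(ℚ)_p = 0` then `Sel_E(ℚ_∞)_p = 0`") for Kobayashi's plus structure of the additive twist.
The `η`-side reading for crux 19606 — on these rows Kobayashi's even main conjecture at `η` for
`(V,p)` IS `L_p⁺(V,η,X) ∈ Λˣ`, which the lower half of `BSD_p(W)` (there: `v_p(L(W,1)/Ω_W) ≤ 0`)
supplies — is the companion file `…PlusEtaNonsurjMuSaturation.lean`.

HONEST FRAMING (cell `bsd-potss`, run/shared/lean/pub/bsd-potss/; FULL-BSD rank ≤ 1 programme,
tranche 1b, HUMAN RULING D-0036/D-0074): TOOL THEOREMS ONLY — no definition, no named Literature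
fact, no Summits-side `def … : Prop`, no `sorry`, axioms standard; UNCONDITIONAL (no named fact in
hypothesis position; the per-row inputs `Sel_{p^∞}(W/ℚ) = 0`, `p ∤ Tam(W)` are DISPLAYED binders).
Nothing about (C1⁺_η) / `BSD(W,p)` is claimed here; the crux 19606 stays OPEN; nothing is booked; no
label / mark / count moves. `--supports stmt-BirchSwinnertonDyer-19606`.

References: [GreenbergLNM1716] §3 Lemma 3.2–3.3 (pp. 86–88), Prop. 3.8 (pp. 95–96); [Kobayashi2003]
Def. 2.1 (p. 5), Lemma 9.1 (p. 25), Thm. 9.3 with (9.33) (pp. 26–27).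
-/

set_option autoImplicit false
set_option linter.dupNamespace false

noncomputable section

open scoped Classical

open Field Function NumberField IsDedekindDomain WeierstrassCurve
open Literature.NumberTheory.EllipticCurves
open Literature.NumberTheory.GaloisRepresentations
open Literature.NumberTheory.EllipticCurves.IwasawaAlgebra
open Literature.NumberTheory.EllipticCurves.IwasawaDual ZpExtension
open Summit.BirchSwinnertonDyer.Rank1Residual.Additive

universe u

namespace Summit.BirchSwinnertonDyer.BirchSwinnertonDyer.Theorems

namespace EtaBottomLayer

section Twist

variable {p : ℕ} [hp : Fact p.Prime] (κ : ZpExtension ℚ p) (W : WeierstrassCurve ℚ) [W.IsElliptic]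
  [W.IsGloballyMinimal]

/-! ## §3 The unit rows: `p ∤ Tam(W)` ⟹ `A₀⁺ = Sel⁺(W/ℚ_0)`; with `Sel_{p^∞}(W/ℚ) = 0`, `X⁺ = 0` -/

/-- **`p ∤ Tam(W)` (and `p ≥ 5`) ⟹ `A₀⁺ ≤ Sel⁺(W/ℚ_0)`**, i.e. `A₀⁺ = Sel⁺(W/ℚ_0)`: every local
receptacle `𝒦_{v,0}[p^∞]` away from `p` has order `p^{ord_p c_v(W)} = 1` (`c_p(W) ≤ 4 < p`,
`∑_{v ≠ p} ord_p c_v = ord_p Tam(W) = 0`), so the index of §2 is `1`.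
[cite: GreenbergLNM1716, §3 Lemma 3.3 (pp. 86–88), Prop. 3.8 (p. 95)] [cite: Kobayashi2003, Thm. 9.3 with (9.33)] -/
theorem localPreimage_le_layer_of_not_dvd_tamagawa (hp5 : 5 ≤ p) (hκ : κ.IsCyclotomic)
    (C : VariableChange ℚ) (V : WeierstrassCurve ℚ) [V.IsElliptic] [V.IsGloballyMinimal]
    (hCV : C • W.quadraticTwist ((-1) ^ (p / 2) * p) = V)
    (hgood : V.HasGoodReductionAtPrime p) (hap : V.frobeniusTrace p = 0)
    (hTam : ¬ p ∣ W.tamagawaProduct) :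
    (W.selmerInfty κ ⊓
          ⨅ σ : Field.absoluteGaloisGroup ℚ,
            (Kobayashi2003.localKummerOverOfEmb W p κ.kerSubgroup (closureEmb (K := ℚ) ℚ_[p])
                (⨆ m, strictSignedLocalPoints κ ℚ_[p] W 1 m)).comap (W.conjH1 p κ.kerSubgroup σ)).comap
          (W.layerToInfty κ 0) ≤ strictSignedSelmerLayer W κ ℚ_[p] 1 0 := by
  have hp2 : p ≠ 2 := by omega
  obtain ⟨S, hS⟩ := exists_finset_forall_not_mem_good W p
  set v₀ := (Rat.HeightOneSpectrum.primesEquiv (R := 𝓞 ℚ)).symm ⟨p, hp.out⟩ with hv₀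
  set A := (W.selmerInfty κ ⊓
      ⨅ σ : Field.absoluteGaloisGroup ℚ,
        (Kobayashi2003.localKummerOverOfEmb W p κ.kerSubgroup (closureEmb (K := ℚ) ℚ_[p])
            (⨆ m, strictSignedLocalPoints κ ℚ_[p] W 1 m)).comap (W.conjH1 p κ.kerSubgroup σ)).comap
      (W.layerToInfty κ 0) with hAdef
  set S0 := strictSignedSelmerLayer W κ ℚ_[p] 1 0 with hS0
  set T := S.filter (fun v ↦ (p : 𝓞 ℚ) ∉ v.asIdeal) with hT
  -- `∑_{v ∈ T} ord_p c_v = ord_p Tam(W) = 0`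
  have hv₀p : (p : 𝓞 ℚ) ∈ v₀.asIdeal := (natCast_mem_asIdeal_iff_eq_primesEquiv_symm v₀ hp.out).mpr rfl
  have hpT : v₀ ∉ T := fun h ↦ (Finset.mem_filter.mp h).2 hv₀p
  have hTmem : ∀ v : HeightOneSpectrum (𝓞 ℚ), v ≠ v₀ →
      p ∣ (W.baseChange (v.adicCompletion ℚ)).localTamagawaNumber (v.adicCompletionIntegers ℚ) → v ∈ T := by
    intro v hv hdvd
    refine Finset.mem_filter.mpr ⟨?_, fun hpv ↦ hv ((natCast_mem_asIdeal_iff_eq_primesEquiv_symm v hp.out).mp hpv)⟩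
    by_contra hvS
    rw [W.localTamagawaNumber_eq_one_of_hasGoodReductionAt_holds v (hS v hvS).2] at hdvd
    exact hp.out.one_lt.ne' (Nat.dvd_one.mp hdvd)
  have hc0 := LevelBridge.padicValNat_localTamagawaNumber_eq_zero_of_quadraticTwist_signedPrime W p hp5 C V
    hCV hgood
  have hTamSum := LevelBridge.sum_padicValNat_localTamagawaNumber_eq_padicValNat_tamagawaProduct W p T hpT
    hTmem hc0
  have hTam0 : padicValNat p W.tamagawaProduct = 0 := padicValNat.eq_zero_of_not_dvd hTam
  have hprod : ∏ v ∈ T, p ^ padicValNat p ((W.baseChange (v.adicCompletion ℚ)).localTamagawaNumber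
      (v.adicCompletionIntegers ℚ)) = 1 := by
    rw [Finset.prod_pow_eq_pow_sum, hTamSum, hTam0, pow_zero]
  -- the index is `1`
  have hdvd := natCard_quotient_dvd_prod_pow κ W hp2 hκ C V hCV hgood hap S hS
  rw [← hT, hprod, Nat.dvd_one] at hdvd
  have htop : S0.addSubgroupOf A = ⊤ := AddSubgroup.index_eq_one.mp hdvd
  exact AddSubgroup.addSubgroupOf_eq_top.mp htop

/-- **The unit rows: `Sel_{p^∞}(W/ℚ) = 0` and `p ∤ Tam(W)` ⟹ `A₀⁺ = Sel^{loc,∞,+}(W/ℚ) = 0`**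
(`A₀⁺ = Sel⁺(W/ℚ_0)` by the previous theorem, and `#Sel⁺(W/ℚ_0) = #Sel_{p^∞}(W/ℚ) = 1`).
[cite: GreenbergLNM1716, §3 Prop. 3.8 (p. 95)] [cite: Kobayashi2003, Thm. 9.3 with (9.33) (pp. 26–27)] -/
theorem localPreimage_trivial_of_selmer_trivial_of_not_dvd_tamagawa (hp5 : 5 ≤ p) (hκ : κ.IsCyclotomic)
    (C : VariableChange ℚ) (V : WeierstrassCurve ℚ) [V.IsElliptic] [V.IsGloballyMinimal]
    (hCV : C • W.quadraticTwist ((-1) ^ (p / 2) * p) = V)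
    (hgood : V.HasGoodReductionAtPrime p) (hap : V.frobeniusTrace p = 0)
    (hSel : W.selmerGroupPInfty p = ⊥) (hTam : ¬ p ∣ W.tamagawaProduct) :
    ∀ y ∈ (W.selmerInfty κ ⊓
          ⨅ σ : Field.absoluteGaloisGroup ℚ,
            (Kobayashi2003.localKummerOverOfEmb W p κ.kerSubgroup (closureEmb (K := ℚ) ℚ_[p])
                (⨆ m, strictSignedLocalPoints κ ℚ_[p] W 1 m)).comap (W.conjH1 p κ.kerSubgroup σ)).comap
          (W.layerToInfty κ 0), y = 0 := by
  intro y hy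
  have hle := localPreimage_le_layer_of_not_dvd_tamagawa κ W hp5 hκ C V hCV hgood hap hTam
  have hcard : Nat.card (strictSignedSelmerLayer W κ ℚ_[p] 1 0) = 1 := by
    rw [StrictSignedLayerZero.natCard_strictSignedSelmerLayer_one_zero_eq_selmerGroupPInfty W κ, hSel]
    exact Nat.card_unique
  have hsub := (Nat.card_eq_one_iff_unique.mp hcard).1
  exact congrArg Subtype.val (Subsingleton.elim (⟨y, hle hy⟩ : strictSignedSelmerLayer W κ ℚ_[p] 1 0) 0)

/-- **The unit rows: `Sel_{p^∞}(W/ℚ) = 0` and `p ∤ Tam(W)` ⟹ `(Sel⁺(W/ℚ_∞))^γ = 0`** — a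
`conj_γ`-fixed class of `Sel⁺(W/ℚ_∞)` is `h₀ y` with `y ∈ h₀⁻¹(Sel⁺_∞) = A₀⁺` (Greenberg's Lemma 3.2,
`cd_p Γ = 1`: `SubSelmerControlZero.exists_layerToInfty_eq_of_mem_endInvariants`; x1b's B2
`comap_layerToInfty_zero_strictSignedSelmerInfty_eq`), and `A₀⁺ = 0`.
[cite: GreenbergLNM1716, §3 Lemma 3.2 (p. 86), Prop. 3.8 (proof, p. 96)] [cite: Kobayashi2003, Lemma 9.1 (p. 25)] -/
theorem invariants_trivial_of_selmer_trivial_of_not_dvd_tamagawa (hp5 : 5 ≤ p) (hκ : κ.IsCyclotomic)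
    (C : VariableChange ℚ) (V : WeierstrassCurve ℚ) [V.IsElliptic] [V.IsGloballyMinimal]
    (hCV : C • W.quadraticTwist ((-1) ^ (p / 2) * p) = V)
    (hgood : V.HasGoodReductionAtPrime p) (hap : V.frobeniusTrace p = 0)
    {γ : Field.absoluteGaloisGroup ℚ} (hγ : κ.IsTopGenerator γ)
    (hSel : W.selmerGroupPInfty p = ⊥) (hTam : ¬ p ∣ W.tamagawaProduct)
    (s : strictSignedSelmerInfty W κ ℚ_[p] 1)
    (hs : W.conjH1 p κ.kerSubgroup γ (s : W.subgroupH1 p κ.kerSubgroup) = s) : s = 0 := by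
  have hp2 : p ≠ 2 := by omega
  obtain ⟨M, hΔ, hA, hVM⟩ := exists_goodSupersingularPadicModel hp2 V hgood hap
  obtain ⟨S, hS⟩ := exists_finset_forall_not_mem_good W p
  have hc := sq_ne_neg_one_pow_mul_prime hp.out (p / 2)
  have htors := eq_zero_of_prime_pow_smul_eq_zero_localFixedPointsOfEmb_kerSubgroup_of_quadraticTwist κ
    (closureEmb (K := ℚ) ℚ_[p]) hp2 W hc C hCV M hΔ hA hVM
  have hA₀ := comap_layerToInfty_zero_strictSignedSelmerInfty_eq W κ ℚ_[p] 1 S hS htors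
  -- `s` is in the kernel of `ψ = conj_γ − 1`
  have hψ : s ∈ endInvariants (conjStrictSignedSelmerInfty W κ ℚ_[p] 1 γ - 1) := by
    rw [mem_endInvariants_iff]
    apply Subtype.ext
    rw [coe_conjStrictSignedSelmerInfty_sub_one_apply, hs, sub_self, ZeroMemClass.coe_zero]
  obtain ⟨y, hyA, hy⟩ := SubSelmerControlZero.exists_layerToInfty_eq_of_mem_endInvariants W hγ
    (coe_conjStrictSignedSelmerInfty_sub_one_apply W κ ℚ_[p] 1 γ) hψ
  rw [hA₀] at hyA
  have hy0 := localPreimage_trivial_of_selmer_trivial_of_not_dvd_tamagawa κ W hp5 hκ C V hCV hgood hap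
    hSel hTam y hyA
  apply Subtype.ext
  rw [← hy, hy0, map_zero, ZeroMemClass.coe_zero]

/-- **THE UNIT ROWS, W-side: `Sel_{p^∞}(W/ℚ) = 0` and `p ∤ Tam(W)` ⟹ `X⁺_W(ℚ_∞) = 0` — i.e.
`X⁺(V/K_∞)^η = 0` — for EVERY Pontryagin-dual datum `D` of `Sel⁺(W/ℚ_∞)`** (`p ≥ 5`, `W` the
`p*`-twist of a globally minimal good `a_p = 0` curve `V`, `κ` cyclotomic, `γ` a topological
generator): the previous theorem and §1b. Greenberg's Prop. 3.8 for Kobayashi's plus structure of the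
additive twist — NO Kato, NO hypothesis on the image of `ρ_{V,p}`, NO Thm. 2.2 / Kitajima–Otsuki /
Poitou–Tate; hence `Char = Λ`, `μ = λ = 0`, and Kobayashi's even main conjecture at `η` for `(V,p)`
reads `L_p⁺(V,η,X) ∈ Λˣ` (companion file). [cite: GreenbergLNM1716, §3 Prop. 3.8 (pp. 95–96)]
[cite: Kobayashi2003, Def. 2.1 (p. 5), Thm. 9.3 with (9.33) (pp. 26–27)] -/
theorem subsingleton_X_of_selmer_trivial_of_not_dvd_tamagawa (hp5 : 5 ≤ p) (hκ : κ.IsCyclotomic)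
    (C : VariableChange ℚ) (V : WeierstrassCurve ℚ) [V.IsElliptic] [V.IsGloballyMinimal]
    (hCV : C • W.quadraticTwist ((-1) ^ (p / 2) * p) = V)
    (hgood : V.HasGoodReductionAtPrime p) (hap : V.frobeniusTrace p = 0)
    {γ : Field.absoluteGaloisGroup ℚ} (hγ : κ.IsTopGenerator γ)
    (hSel : W.selmerGroupPInfty p = ⊥) (hTam : ¬ p ∣ W.tamagawaProduct)
    (D : StrictSignedSelmerDualData W κ ℚ_[p] γ 1) : Subsingleton D.X :=
  subsingleton_X_of_invariants_trivial W κ ℚ_[p] 1 hγ D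
    (invariants_trivial_of_selmer_trivial_of_not_dvd_tamagawa κ W hp5 hκ C V hCV hgood hap hγ hSel hTam)

end Twist

end EtaBottomLayer

end Summit.BirchSwinnertonDyer.BirchSwinnertonDyer.Theorems

end
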